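import Summits.CriticalPhenomena.PercolationContinuityZ3.Theorems.Transplant.FKConnectivityAllQForestAdjacentSeparatorTransfer
import Summits.CriticalPhenomena.PercolationContinuityZ3.Theorems.Transplant.FKConnectivityAllQForestAdjacentDegThree
import HarnessLib

/-!
# The square-free adjacent forest node across a separator: the inequality lives on the doubly trace-asymmetric colourings

builds on p205010 (kernel theorem, internal audit signed; external expert review pending).  No definitions, no named facts, no sorries;
standard axioms.

Residual form of the general transfer theorem `adjForestNoSq_fibre_eq_of_sepTrace` (`…ForestAdjacentSeparatorTransfer`; memo
bschramm/FROM-fk-1-g20-SEPARATOR-EXCHANGE.md §2–§3).  Geometry as there: sides `E₁ ∋ e` (on `V₁`), `E₂ ∋ f` (on `V₂`), gadget `ES`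
inside `S ⊇ V₁ ∩ V₂`, pairwise disjoint, fibre `(M', u₀)` inside their union.  Call a valid colouring `(ω, ω ∆ M')` DICHOTOMOUS if its
two side-2 classes have the same trace on `S` or its two side-1 classes do, and RESIDUAL otherwise (both sides trace-asymmetric).
* `forest_pair_transfer_pointwise` — the involution `Φ` of the transfer theorem is valid on every dichotomous colouring and maps
  dichotomous to dichotomous (no global hypothesis).
* **`adjForestNoSq_fibre_residual`** — `bad + good_R = good + bad_R`: the node's two fibre counts differ exactly by the difference of
  their RESIDUAL parts; in particular (`adjForestNoSq_fibre_le_iff_residual`) the node's inequality on the fibre is EQUIVALENT to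
  `bad_R ≤ good_R`, a statement about residual colourings only (empty for dense separators and tight sets: `…DenseSeparator`).
  First customer (memo §3): for the path gadget `{op, oq}` a second involution pairs all residual colourings except those whose two
  non-discrete traces are both `{pq}`, leaving `bad − good = −2·x₁(d,pq)·x₂(d,pq)`.
[cite: Grimmett2006, §1.5 (p. 13); §3.8 (pp. 61–62); §4.2 Lemma (4.13)] [cite: SempleWelsh2008, Conj. 1.1 (p. 2)] [cite: Linusson2011, Prop. 2.6]
-/

noncomputable section

namespace Summit.CriticalPhenomena.PercolationContinuityZ3.Theorems

namespace FK

open Set SimpleGraph Literature.Probability.LatticeModels Literature.Probability.Percolation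
open scoped Classical

variable {V : Type*} [Fintype V]

section Residual

open scoped symmDiff

variable {E₁ E₂ ES : Set (Sym2 V)} {V₁ V₂ S : Set V} {M u₀ : BondConfig V} {o v y : V}

/-- **The transfer step, pointwise.**  Same `Φ` as `forest_pair_transfer_of_sepTrace`, but the trace dichotomy is assumed only
for the colouring at hand; in addition `Φ ω` again satisfies the dichotomy (its side-2 traces are the old ones swapped, its side-1
classes are the old ones).  This is what restricts the involution to the dichotomy part of a fibre. [cite: Grimmett2006, §3.8 (pp. 61–62); §4.2 Lemma (4.13)] [cite: Linusson2011, Prop. 2.6] -/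
theorem forest_pair_transfer_pointwise (h₁ : ∀ e ∈ E₁, ∀ z ∈ e, z ∈ V₁) (h₂ : ∀ e ∈ E₂, ∀ z ∈ e, z ∈ V₂)
    (hES : ∀ e ∈ ES, ∀ z ∈ e, z ∈ S) (hS : V₁ ∩ V₂ ⊆ S)
    (hd : Disjoint E₁ E₂) (hd₁ : Disjoint ES E₁) (hd₂ : Disjoint ES E₂) {M' : BondConfig V}
    (hM' : M' ∪ u₀ ⊆ ES ∪ (E₁ ∪ E₂))
    (Φ : BondConfig V → BondConfig V)
    (hΦ : ∀ ω, Φ ω = if (∀ x ∈ S, ∀ y' ∈ S, (openGraph (ω ∩ E₂)).Reachable x y' ↔ (openGraph ((ω ∆ M') ∩ E₂)).Reachable x y')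
      then ω ∆ (M' ∩ E₂) else ω ∆ (M' ∩ (ES ∪ E₂)))
    {ω : BondConfig V} (hω : ω \ M' = u₀) (hF : IsForestCfg ω) (hFB : IsForestCfg (ω ∆ M'))
    (hHω : (∀ x ∈ S, ∀ y' ∈ S, (openGraph (ω ∩ E₂)).Reachable x y' ↔ (openGraph ((ω ∆ M') ∩ E₂)).Reachable x y') ∨
      (∀ x ∈ S, ∀ y' ∈ S, (openGraph (ω ∩ E₁)).Reachable x y' ↔ (openGraph ((ω ∆ M') ∩ E₁)).Reachable x y')) :
    Φ ω \ M' = u₀ ∧ IsForestCfg (Φ ω) ∧ IsForestCfg ((Φ ω) ∆ M') ∧ Φ (Φ ω) = ω ∧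
      (∀ x ∈ E₁, x ∈ Φ ω ↔ x ∈ ω) ∧ (∀ x ∈ M', x ∈ E₂ → (x ∈ Φ ω ↔ x ∉ ω)) ∧
      ((∀ x ∈ S, ∀ y' ∈ S, (openGraph ((Φ ω) ∩ E₂)).Reachable x y' ↔ (openGraph (((Φ ω) ∆ M') ∩ E₂)).Reachable x y') ∨
        (∀ x ∈ S, ∀ y' ∈ S, (openGraph ((Φ ω) ∩ E₁)).Reachable x y' ↔ (openGraph (((Φ ω) ∆ M') ∩ E₁)).Reachable x y')) := by
  set N₀ : BondConfig V := M' ∩ E₂ with hN₀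
  set N₁ : BondConfig V := M' ∩ (ES ∪ E₂) with hN₁
  have hn₁ : ∀ g ∈ ES, g ∉ E₁ := fun g hg h => Set.disjoint_left.1 hd₁ hg h
  have hn₂ : ∀ g ∈ ES, g ∉ E₂ := fun g hg h => Set.disjoint_left.1 hd₂ hg h
  have hE : ∀ x, x ∈ E₁ → x ∉ E₂ := fun x hx1 hx2 => Set.disjoint_left.1 hd hx1 hx2
  -- where the configurations live
  have hM'sub : M' ⊆ ES ∪ (E₁ ∪ E₂) := fun x hx => hM' (Or.inl hx)
  have hωsub : ω ⊆ ES ∪ (E₁ ∪ E₂) := fun x hx => by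
    by_cases hxM : x ∈ M'
    · exact hM'sub hxM
    · exact hM' (Or.inr (hω ▸ ⟨hx, hxM⟩))
  have hsd : ∀ {X N : BondConfig V}, X ⊆ ES ∪ (E₁ ∪ E₂) → N ⊆ M' → X ∆ N ⊆ ES ∪ (E₁ ∪ E₂) := by
    intro X N hX hN x hx
    rw [Set.mem_symmDiff] at hx
    rcases hx with ⟨hx, -⟩ | ⟨hx, -⟩
    · exact hX hx
    · exact hM'sub (hN hx)
  have hωBsub : ω ∆ M' ⊆ ES ∪ (E₁ ∪ E₂) := hsd hωsub subset_rfl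
  -- splitting a configuration into (gadget + one side) and (other side)
  have split₂ : ∀ {X : BondConfig V}, X ⊆ ES ∪ (E₁ ∪ E₂) → X ∩ (ES ∪ E₁) ∪ X ∩ E₂ = X := fun hX => by
    rw [← inter_union_distrib_left, union_assoc]; exact inter_eq_self_of_subset_left hX
  have split₁ : ∀ {X : BondConfig V}, X ⊆ ES ∪ (E₁ ∪ E₂) → X ∩ (ES ∪ E₂) ∪ X ∩ E₁ = X := fun hX => by
    rw [← inter_union_distrib_left, union_assoc, union_comm E₂ E₁]; exact inter_eq_self_of_subset_left hX
  -- the two recolouring sets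
  have hN₀M : N₀ ⊆ M' := inter_subset_left
  have hN₁M : N₁ ⊆ M' := inter_subset_left
  have hN₀out : ∀ x ∈ N₀, x ∉ ES ∪ E₁ := by
    rintro x ⟨-, hx2⟩ (hx | hx)
    · exact hn₂ x hx hx2
    · exact hE x hx hx2
  have hN₁out : ∀ x ∈ N₁, x ∉ E₁ := by
    rintro x ⟨-, hx | hx⟩ hx1
    · exact hn₁ x hx hx1
    · exact hE x hx1 hx
  have hMN₀ : ∀ x ∈ M', x ∈ E₂ → x ∈ N₀ := fun x hx hx2 => ⟨hx, hx2⟩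
  have hMN₁ : ∀ x ∈ M', x ∈ ES ∪ E₂ → x ∈ N₁ := fun x hx hx2 => ⟨hx, hx2⟩
  have hMN₁' : ∀ x ∈ M', x ∈ E₂ → x ∈ N₁ := fun x hx hx2 => ⟨hx, Or.inr hx2⟩
  have hN₀E₁ : ∀ x ∈ N₀, x ∉ E₁ := fun x hx hx1 => hN₀out x hx (Or.inr hx1)
  by_cases hQ : ∀ x ∈ S, ∀ y' ∈ S, (openGraph (ω ∩ E₂)).Reachable x y' ↔ (openGraph ((ω ∆ M') ∩ E₂)).Reachable x y'
  · -- the side-2 traces agree: recolour side 2 only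
    have hΦω : Φ ω = ω ∆ N₀ := by rw [hΦ ω, if_pos hQ]
    have hT1 : (ω ∆ N₀) ∩ (ES ∪ E₁) = ω ∩ (ES ∪ E₁) := symmDiff_inter_eq_of_disjoint hN₀out
    have hT2 : (ω ∆ N₀) ∩ E₂ = (ω ∆ M') ∩ E₂ := symmDiff_inter_eq_partner hN₀M hMN₀
    have hT3 : ((ω ∆ N₀) ∆ M') ∩ (ES ∪ E₁) = (ω ∆ M') ∩ (ES ∪ E₁) := symmDiff_symmDiff_inter_eq_partner hN₀M hN₀out
    have hT4 : ((ω ∆ N₀) ∆ M') ∩ E₂ = ω ∩ E₂ := symmDiff_symmDiff_inter_eq_self hN₀M hMN₀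
    have hval₁ : IsForestCfg (ω ∆ N₀) := by
      rw [← split₂ (hsd hωsub hN₀M), hT1, hT2]
      exact isForestCfg_glue₂_of_trace h₁ h₂ hES hS hd hd₂ hωsub hF hFB hQ
    have hval₂ : IsForestCfg ((ω ∆ N₀) ∆ M') := by
      rw [← split₂ (hsd (hsd hωsub hN₀M) subset_rfl), hT3, hT4]
      exact isForestCfg_glue₂_of_trace h₁ h₂ hES hS hd hd₂ hωBsub hFB hF (trace_iff_comm.1 hQ)
    have hQ' : ∀ x ∈ S, ∀ y' ∈ S, (openGraph ((ω ∆ N₀) ∩ E₂)).Reachable x y' ↔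
        (openGraph (((ω ∆ N₀) ∆ M') ∩ E₂)).Reachable x y' := by
      rw [hT2, hT4]; exact trace_iff_comm.1 hQ
    refine ⟨by rw [hΦω, symmDiff_sdiff_eq_of_subset hN₀M, hω], hΦω ▸ hval₁, hΦω ▸ hval₂, ?_,
      fun x hx => by rw [hΦω]; exact mem_symmDiff_iff_of_notMem (fun h => hN₀E₁ x h hx),
      fun x hxM hx2 => by rw [hΦω]; exact mem_symmDiff_iff_of_mem (hMN₀ x hxM hx2), by rw [hΦω]; exact Or.inl hQ'⟩
    rw [hΦω, hΦ (ω ∆ N₀), if_pos hQ']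
    exact symmDiff_symmDiff_cancel_right _ _
  · -- the side-2 traces differ: the side-1 traces agree (dichotomy); recolour side 2 AND the gadget
    have hΦω : Φ ω = ω ∆ N₁ := by rw [hΦ ω, if_neg hQ]
    have hP₁ : ∀ x ∈ S, ∀ y' ∈ S, (openGraph (ω ∩ E₁)).Reachable x y' ↔ (openGraph ((ω ∆ M') ∩ E₁)).Reachable x y' :=
      hHω.resolve_left hQ
    have hT1 : (ω ∆ N₁) ∩ E₁ = ω ∩ E₁ := symmDiff_inter_eq_of_disjoint hN₁out
    have hT2 : (ω ∆ N₁) ∩ (ES ∪ E₂) = (ω ∆ M') ∩ (ES ∪ E₂) := symmDiff_inter_eq_partner hN₁M hMN₁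
    have hT2' : (ω ∆ N₁) ∩ E₂ = (ω ∆ M') ∩ E₂ := symmDiff_inter_eq_partner hN₁M hMN₁'
    have hT3 : ((ω ∆ N₁) ∆ M') ∩ E₁ = (ω ∆ M') ∩ E₁ := symmDiff_symmDiff_inter_eq_partner hN₁M hN₁out
    have hT4 : ((ω ∆ N₁) ∆ M') ∩ (ES ∪ E₂) = ω ∩ (ES ∪ E₂) := symmDiff_symmDiff_inter_eq_self hN₁M hMN₁
    have hT4' : ((ω ∆ N₁) ∆ M') ∩ E₂ = ω ∩ E₂ := symmDiff_symmDiff_inter_eq_self hN₁M hMN₁'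
    have hval₁ : IsForestCfg (ω ∆ N₁) := by
      rw [← split₁ (hsd hωsub hN₁M), hT1, hT2]
      exact isForestCfg_glue₁_of_trace h₁ h₂ hES hS hd hd₁ hωBsub hFB hF (trace_iff_comm.1 hP₁)
    have hval₂ : IsForestCfg ((ω ∆ N₁) ∆ M') := by
      rw [← split₁ (hsd (hsd hωsub hN₁M) subset_rfl), hT3, hT4]
      exact isForestCfg_glue₁_of_trace h₁ h₂ hES hS hd hd₁ hωsub hF hFB hP₁
    have hQ' : ¬ ∀ x ∈ S, ∀ y' ∈ S, (openGraph ((ω ∆ N₁) ∩ E₂)).Reachable x y' ↔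
        (openGraph (((ω ∆ N₁) ∆ M') ∩ E₂)).Reachable x y' := by
      rw [hT2', hT4', ← trace_iff_comm]; exact hQ
    have hP₁' : ∀ x ∈ S, ∀ y' ∈ S, (openGraph ((ω ∆ N₁) ∩ E₁)).Reachable x y' ↔
        (openGraph (((ω ∆ N₁) ∆ M') ∩ E₁)).Reachable x y' := by
      rw [hT1, hT3]; exact hP₁
    refine ⟨by rw [hΦω, symmDiff_sdiff_eq_of_subset hN₁M, hω], hΦω ▸ hval₁, hΦω ▸ hval₂, ?_,
      fun x hx => by rw [hΦω]; exact mem_symmDiff_iff_of_notMem (fun h => hN₁out x h hx),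
      fun x hxM hx2 => by rw [hΦω]; exact mem_symmDiff_iff_of_mem (hMN₁' x hxM hx2), by rw [hΦω]; exact Or.inr hP₁'⟩
    rw [hΦω, hΦ (ω ∆ N₁), if_neg hQ']
    exact symmDiff_symmDiff_cancel_right _ _


/-- **The node's inequality lives on the residual colourings.**  Fibre `(M ∪ {e, f}, u₀)`, `e = ov ∈ E₁`, `f = oy ∈ E₂`, geometry as
in `adjForestNoSq_fibre_eq_of_sepTrace`; `D` = the dichotomous colourings (equal side-2 traces or equal side-1 traces on `S`).  Then
`#(Fo ∩ {e,f ∈ ω}, Fo) + #(Fo ∩ {e ∈ ω} ∩ Dᶜ, Fo ∩ {f ∈ ω}) = #(Fo ∩ {e ∈ ω}, Fo ∩ {f ∈ ω}) + #(Fo ∩ {e,f ∈ ω} ∩ Dᶜ, Fo)`: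
`bad − good = bad_R − good_R`. [cite: SempleWelsh2008, Conj. 1.1 (p. 2)] [cite: Linusson2011, Prop. 2.6] [cite: Grimmett2006, §3.8 (pp. 61–62)] -/
theorem adjForestNoSq_fibre_residual (h₁ : ∀ e ∈ E₁, ∀ z ∈ e, z ∈ V₁) (h₂ : ∀ e ∈ E₂, ∀ z ∈ e, z ∈ V₂)
    (hES : ∀ e ∈ ES, ∀ z ∈ e, z ∈ S) (hS : V₁ ∩ V₂ ⊆ S)
    (hd : Disjoint E₁ E₂) (hd₁ : Disjoint ES E₁) (hd₂ : Disjoint ES E₂) (heE : s(o, v) ∈ E₁) (hfE : s(o, y) ∈ E₂)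
    (hsub : insert s(o, y) (insert s(o, v) M) ∪ u₀ ⊆ ES ∪ (E₁ ∪ E₂))
    (D : Set (BondConfig V))
    (hD : ∀ ω, ω ∈ D ↔
      ((∀ x ∈ S, ∀ y' ∈ S, (openGraph (ω ∩ E₂)).Reachable x y' ↔
        (openGraph ((ω ∆ insert s(o, y) (insert s(o, v) M)) ∩ E₂)).Reachable x y') ∨
      (∀ x ∈ S, ∀ y' ∈ S, (openGraph (ω ∩ E₁)).Reachable x y' ↔
        (openGraph ((ω ∆ insert s(o, y) (insert s(o, v) M)) ∩ E₁)).Reachable x y'))) :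
    fibreCount (insert s(o, y) (insert s(o, v) M)) u₀ (forestEv V ∩ {ω | s(o, v) ∈ ω ∧ s(o, y) ∈ ω}) (forestEv V) +
      fibreCount (insert s(o, y) (insert s(o, v) M)) u₀ (forestEv V ∩ {ω | s(o, v) ∈ ω} ∩ Dᶜ) (forestEv V ∩ {ω | s(o, y) ∈ ω}) =
    fibreCount (insert s(o, y) (insert s(o, v) M)) u₀ (forestEv V ∩ {ω | s(o, v) ∈ ω}) (forestEv V ∩ {ω | s(o, y) ∈ ω}) +
      fibreCount (insert s(o, y) (insert s(o, v) M)) u₀ (forestEv V ∩ {ω | s(o, v) ∈ ω ∧ s(o, y) ∈ ω} ∩ Dᶜ) (forestEv V) := by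
  set M' : BondConfig V := insert s(o, y) (insert s(o, v) M) with hM'
  -- split both counts along `D`
  have splitA : ∀ (A B : Set (BondConfig V)), fibreCount M' u₀ A B = fibreCount M' u₀ (A ∩ D) B + fibreCount M' u₀ (A ∩ Dᶜ) B := by
    intro A B
    rw [← fibreCount_split_left M' u₀ B (Set.disjoint_of_subset inter_subset_right inter_subset_right disjoint_compl_right),
      ← inter_union_distrib_left, union_compl_self, inter_univ]
  -- the involution on the dichotomous part
  set Φ : BondConfig V → BondConfig V := fun ω =>
    if (∀ x ∈ S, ∀ y' ∈ S, (openGraph (ω ∩ E₂)).Reachable x y' ↔ (openGraph ((ω ∆ M') ∩ E₂)).Reachable x y')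
      then ω ∆ (M' ∩ E₂) else ω ∆ (M' ∩ (ES ∪ E₂)) with hΦdef
  have hΦ : ∀ ω, Φ ω =
      if (∀ x ∈ S, ∀ y' ∈ S, (openGraph (ω ∩ E₂)).Reachable x y' ↔ (openGraph ((ω ∆ M') ∩ E₂)).Reachable x y')
      then ω ∆ (M' ∩ E₂) else ω ∆ (M' ∩ (ES ∪ E₂)) := fun ω => rfl
  have hfM : s(o, y) ∈ M' := mem_insert _ _
  have hfB : ∀ X : BondConfig V, s(o, y) ∈ X ∆ M' ↔ s(o, y) ∉ X := fun X => mem_symmDiff_iff_of_mem hfM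
  have hbij : fibreCount M' u₀ (forestEv V ∩ {ω | s(o, v) ∈ ω ∧ s(o, y) ∈ ω} ∩ D) (forestEv V) =
      fibreCount M' u₀ (forestEv V ∩ {ω | s(o, v) ∈ ω} ∩ D) (forestEv V ∩ {ω | s(o, y) ∈ ω}) := by
    refine fibreCount_eq_of_bij Φ Φ (fun ω hω hA hB => ?_) (fun ω hω hA hB => ?_)
    · obtain ⟨⟨hF, he, hf⟩, hDω⟩ := hA
      have hF' : IsForestCfg ω := hF
      have hFB : IsForestCfg (ω ∆ M') := hB
      obtain ⟨hfib, hF1, hF2, hinv, hE1, hE2, hdich⟩ :=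
        forest_pair_transfer_pointwise h₁ h₂ hES hS hd hd₁ hd₂ hsub Φ hΦ hω hF' hFB ((hD ω).1 hDω)
      refine ⟨hfib, ⟨⟨hF1, (hE1 _ heE).2 he⟩, (hD _).2 hdich⟩, ⟨hF2, ?_⟩, hinv⟩
      show s(o, y) ∈ (Φ ω) ∆ M'
      rw [hfB, hE2 _ hfM hfE, not_not]; exact hf
    · obtain ⟨⟨hF, he⟩, hDω⟩ := hA
      obtain ⟨hFB, hf⟩ := hB
      have hF' : IsForestCfg ω := hF
      have hFB' : IsForestCfg (ω ∆ M') := hFB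
      obtain ⟨hfib, hF1, hF2, hinv, hE1, hE2, hdich⟩ :=
        forest_pair_transfer_pointwise h₁ h₂ hES hS hd hd₁ hd₂ hsub Φ hΦ hω hF' hFB' ((hD ω).1 hDω)
      have hfω : s(o, y) ∉ ω := (hfB ω).1 hf
      exact ⟨hfib, ⟨⟨hF1, (hE1 _ heE).2 he, (hE2 _ hfM hfE).2 hfω⟩, (hD _).2 hdich⟩, hF2, hinv⟩
  rw [splitA (forestEv V ∩ {ω | s(o, v) ∈ ω ∧ s(o, y) ∈ ω}) (forestEv V),
    splitA (forestEv V ∩ {ω | s(o, v) ∈ ω}) (forestEv V ∩ {ω | s(o, y) ∈ ω}), hbij]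
  ring

/-- **Corollary**: the node's fibre inequality across the separator holds iff it holds on the residual colourings.
[cite: SempleWelsh2008, Conj. 1.1 (p. 2)] [cite: Linusson2011, Prop. 2.6] -/
theorem adjForestNoSq_fibre_le_iff_residual (h₁ : ∀ e ∈ E₁, ∀ z ∈ e, z ∈ V₁) (h₂ : ∀ e ∈ E₂, ∀ z ∈ e, z ∈ V₂)
    (hES : ∀ e ∈ ES, ∀ z ∈ e, z ∈ S) (hS : V₁ ∩ V₂ ⊆ S)
    (hd : Disjoint E₁ E₂) (hd₁ : Disjoint ES E₁) (hd₂ : Disjoint ES E₂) (heE : s(o, v) ∈ E₁) (hfE : s(o, y) ∈ E₂)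
    (hsub : insert s(o, y) (insert s(o, v) M) ∪ u₀ ⊆ ES ∪ (E₁ ∪ E₂))
    (D : Set (BondConfig V))
    (hD : ∀ ω, ω ∈ D ↔
      ((∀ x ∈ S, ∀ y' ∈ S, (openGraph (ω ∩ E₂)).Reachable x y' ↔
        (openGraph ((ω ∆ insert s(o, y) (insert s(o, v) M)) ∩ E₂)).Reachable x y') ∨
      (∀ x ∈ S, ∀ y' ∈ S, (openGraph (ω ∩ E₁)).Reachable x y' ↔
        (openGraph ((ω ∆ insert s(o, y) (insert s(o, v) M)) ∩ E₁)).Reachable x y'))) :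
    fibreCount (insert s(o, y) (insert s(o, v) M)) u₀ (forestEv V ∩ {ω | s(o, v) ∈ ω ∧ s(o, y) ∈ ω}) (forestEv V) ≤
      fibreCount (insert s(o, y) (insert s(o, v) M)) u₀ (forestEv V ∩ {ω | s(o, v) ∈ ω}) (forestEv V ∩ {ω | s(o, y) ∈ ω}) ↔
    fibreCount (insert s(o, y) (insert s(o, v) M)) u₀ (forestEv V ∩ {ω | s(o, v) ∈ ω ∧ s(o, y) ∈ ω} ∩ Dᶜ) (forestEv V) ≤
      fibreCount (insert s(o, y) (insert s(o, v) M)) u₀ (forestEv V ∩ {ω | s(o, v) ∈ ω} ∩ Dᶜ) (forestEv V ∩ {ω | s(o, y) ∈ ω}) := by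
  have h := adjForestNoSq_fibre_residual h₁ h₂ hES hS hd hd₁ hd₂ heE hfE hsub D hD
  constructor <;> intro hle <;> omega

end Residual

end FK

end Summit.CriticalPhenomena.PercolationContinuityZ3.Theorems

end
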